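import Summits.AtomisticToContinuum.HydrodynamicLimit.Theorems.AntiMazurCoboundariesKineticFluxLdDecayHTheoremBoundedWindows
import Summits.AtomisticToContinuum.HydrodynamicLimit.Theorems.AntiMazurCoboundariesKineticFluxLdDecayVanishingReduction
import Summits.AtomisticToContinuum.HydrodynamicLimit.Theorems.AntiMazurCoboundariesKineticFluxLdDecayTiltEntropyOfCrux
import Summits.AtomisticToContinuum.HydrodynamicLimit.Theorems.AntiMazurCoboundariesKineticFluxLdDecaySecondMomentBudget
import Summits.AtomisticToContinuum.HydrodynamicLimit.Theorems.AntiMazurCoboundariesKineticFluxLdDecayVanishingOfTiltEntropy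
import Summits.AtomisticToContinuum.HydrodynamicLimit.Theorems.AntiMazurCoboundariesKineticFluxLdDecayProductionContinuity
import HarnessLib

/-!
# Normal forms of the crux `KineticFluxLdDecay` (stmt-AtomisticToContinuum-10967) on the line `h-theorem-dissipation-budget`:
# `VanishingWindowDissipationTilt ↔ crux`, `TiltEntropyVanishing ↔ crux`, `crux ↔ crux'` — sorry-free

Lead c5 (reshape 4). The certificate of the line, assembled from the landed stubs of wave 1
(`stub_vanishingReduction` p154786, `stub_tiltEntropyVanishing_of_crux` p154960, `stub_secondMomentBudget` p154799,
`stub_vanishing_of_tiltEntropy` p154673, `stub_productionContinuity` p156933) and the bounded-windows glue of reshape 3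
(`noPerpetualDissipationTilt_iff_largeWindow`, p152128; `stub_hTheoremObjectsE`, p154283):

* `vanishingWindowDissipationTilt_iff_crux` — the weakest core the H-theorem reduction accepts (window-averaged cut Hellinger
  production of the optimal enemy `G_N^X` small at some window) is EQUIVALENT to the crux;
* `tiltEntropyVanishing_iff_crux` — the crux holds iff its Donsker–Varadhan optimiser `G_N^X` has vanishing specific relative
  entropy over long kinetic windows (`KL(G_N^X ‖ G_N) ≤ ε(N+1)` at some window);
* `crux_iff_crux'` — the two route copies (AntiMazurCoboundaries r4, FluxGibbsianityLdDrude r2) are equivalent;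
* `vanishingWindowDissipationTilt_of_noPerpetualDissipationTilt` / `_of_largeWindowDissipationTilt` — the rate-bearing cores of
  reshapes 2–3 imply it (they are the crux with a window rate).

Consequently the line carries no statement strictly between "provable from its inputs" and "the crux": its residue is the crux
itself (N-uniform kinetic-time decorrelation of deterministic hard spheres at fixed reduced density).
-/

noncomputable section

namespace Summit.AtomisticToContinuum.HydrodynamicLimit.Theorems.HTheorem

/-- Statement of the registered certificate stub `stub_hTheoremNormalForms`: the three equivalences of the line. -/
def HTheoremNormalForms : Prop :=
  (VanishingWindowDissipationTilt ↔
      Summit.AtomisticToContinuum.HydrodynamicLimit.Theses.AntiMazurCoboundaries.KineticFluxLdDecay) ∧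
    (TiltEntropyVanishing ↔
      Summit.AtomisticToContinuum.HydrodynamicLimit.Theses.AntiMazurCoboundaries.KineticFluxLdDecay) ∧
    (Summit.AtomisticToContinuum.HydrodynamicLimit.Theses.AntiMazurCoboundaries.KineticFluxLdDecay ↔
      Summit.AtomisticToContinuum.HydrodynamicLimit.Theses.FluxGibbsianityLdDrude.KineticFluxLdDecay)

/-- **Normal form**: the core of reshape 4 is equivalent to the crux (AntiMazurCoboundaries' copy). -/
theorem vanishingWindowDissipationTilt_iff_crux :
    VanishingWindowDissipationTilt ↔
      Summit.AtomisticToContinuum.HydrodynamicLimit.Theses.AntiMazurCoboundaries.KineticFluxLdDecay :=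
  ⟨fun h => (stub_vanishingReduction h).1, fun h =>
    stub_vanishing_of_tiltEntropy stub_productionContinuity stub_secondMomentBudget
      (stub_tiltEntropyVanishing_of_crux h)⟩

/-- **Normal form in entropy currency**: the crux holds iff its optimal enemy is entropically negligible. -/
theorem tiltEntropyVanishing_iff_crux :
    TiltEntropyVanishing ↔
      Summit.AtomisticToContinuum.HydrodynamicLimit.Theses.AntiMazurCoboundaries.KineticFluxLdDecay :=
  ⟨fun h => (stub_vanishingReduction (stub_vanishing_of_tiltEntropy stub_productionContinuity
      stub_secondMomentBudget h)).1, stub_tiltEntropyVanishing_of_crux⟩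

/-- The two route copies of the crux are equivalent. -/
theorem crux_iff_crux' :
    Summit.AtomisticToContinuum.HydrodynamicLimit.Theses.AntiMazurCoboundaries.KineticFluxLdDecay ↔
      Summit.AtomisticToContinuum.HydrodynamicLimit.Theses.FluxGibbsianityLdDrude.KineticFluxLdDecay :=
  ⟨fun h => (stub_vanishingReduction (vanishingWindowDissipationTilt_iff_crux.2 h)).2,
    fun h => (stub_vanishingReduction (vanishingWindowDissipationTilt_iff_crux.2
      (fun a θ u₀ ha hθ => h a θ u₀ ha hθ))).1⟩

/-- The entropy normal form of the FluxGibbsianityLdDrude copy. -/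
theorem tiltEntropyVanishing_iff_crux' :
    TiltEntropyVanishing ↔
      Summit.AtomisticToContinuum.HydrodynamicLimit.Theses.FluxGibbsianityLdDrude.KineticFluxLdDecay :=
  tiltEntropyVanishing_iff_crux.trans crux_iff_crux'

/-- The rate-bearing core of reshape 3 implies the core of reshape 4. -/
theorem vanishingWindowDissipationTilt_of_largeWindowDissipationTilt (h : LargeWindowDissipationTilt) :
    VanishingWindowDissipationTilt :=
  stub_hTheoremObjectsE h

/-- The bet of reshape 2 implies the core of reshape 4. -/
theorem vanishingWindowDissipationTilt_of_noPerpetualDissipationTilt (h : NoPerpetualDissipationTilt) :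
    VanishingWindowDissipationTilt :=
  stub_hTheoremObjectsE (noPerpetualDissipationTilt_iff_largeWindow.1 h)

/-- The bet of reshape 2 makes the optimal enemy entropically negligible (through the crux). -/
theorem tiltEntropyVanishing_of_noPerpetualDissipationTilt (h : NoPerpetualDissipationTilt) : TiltEntropyVanishing :=
  tiltEntropyVanishing_iff_crux.2
    (vanishingWindowDissipationTilt_iff_crux.1 (vanishingWindowDissipationTilt_of_noPerpetualDissipationTilt h))

/-- **Registered certificate stub** `stub_hTheoremNormalForms` (skeleton of line `h-theorem-dissipation-budget`). -/
theorem stub_hTheoremNormalForms : HTheoremNormalForms :=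
  ⟨vanishingWindowDissipationTilt_iff_crux, tiltEntropyVanishing_iff_crux, crux_iff_crux'⟩

end Summit.AtomisticToContinuum.HydrodynamicLimit.Theorems.HTheorem

end
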